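import Mathlib
import HarnessLib
import Summits.HubbardSuperconductivity.HubbardSuperconductivity.Theorems.KLProgrammeKLRegimeTwoVolumeTowerDefs
import Summits.HubbardSuperconductivity.HubbardSuperconductivity.Theorems.KLProgrammeKLRegimeWickEffectiveActionLegDressing
import Summits.HubbardSuperconductivity.HubbardSuperconductivity.Theorems.KLProgrammeKLRegimeEngineTowerBlockIncrWt

/-!
# Route `KLProgramme` — crux K3, VL child `KLRegimeVolumeLimitV17F2` (stmt-HubbardSuperconductivity-20440), blueprint v5 M5: GENERIC FACTS FOR THE DISCHARGERS
# OF `TowerData β U μ` (seat hubbard-kl-k3c4-p1 g13; `--supports` 20440)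

Four data-free entries of the tower data package (`…TowerDataDefs.TowerData`, `…TowerSpineDefs.TowerVolumeData`, `…TowerBaseGridLimit`):

* `klTowerD_parity` — the field `TowerVolumeData.parity` at step `j` from the partition function at scale `j+1` (`klTowerD` is a linear read-out of the even,
  constant-free scale-`(j+1)` action);
* `tower_radius_tendsto`, `tower_radius_deep` — the canonical pin radius `r L = L / (4·n_β + 7)` satisfies the fields `hr`, `hRd` of `TowerData`;
* `tower_radii_sqrt` — the canonical split `R = √r`, `R′ = r − √r` of the grid base (`…TowerBaseGridLimit`): `R + R′ ≤ r`, `(1+R)/(1+(R′+1)) → 0`, `(R′+1)⁻¹ → 0`,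
  `R → ∞`;
* `imagTimeWeight_pos_le_one` — `0 < ε_M ≤ 1` once `β ≤ 2M`.

Proofs only; no definition.
-/

noncomputable section

namespace Summit.HubbardSuperconductivity.HubbardSuperconductivity.Theorems.TwoVolumeSource

set_option linter.dupNamespace false -- summit = problem name (single-conjunct summit), D-0017

open Finset Filter Topology Literature.MathematicalPhysics.QuantumLattice GrassmannAlgebra Literature.Probability.LatticeModels
open Literature.MathematicalPhysics.QuantumLattice.FermiRG
open Summit.HubbardSuperconductivity.HubbardSuperconductivity.Theorems.KLProgrammeLegKernels
open Summit.HubbardSuperconductivity.HubbardSuperconductivity.Theorems.KLRegimeSplit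
open Summit.HubbardSuperconductivity.HubbardSuperconductivity.Theorems.EngineV8
open Summit.HubbardSuperconductivity.HubbardSuperconductivity.Theorems.TwoVolumeDefect

/-- **`TowerVolumeData.parity` at step `j` from `Z^K_{Λ_{j+1}} ≠ 0`**: `klTowerD V M β U μ K j` is even with vanishing constant part. [folklore] -/
theorem klTowerD_parity {V M : ℕ} [NeZero V] [NeZero M] (β U μ : ℝ) (K : TrigPolyC4v) (j : ℕ)
    (hZ : hubbardEffPartitionFnCT V M β U μ 0 K (klScale klE0 (j + 1)) ≠ 0) :
    klTowerD V M β U μ K j ∈ evenOdd ℂ 0 ∧ constPart ℂ (klTowerD V M β U μ K j) = 0 := by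
  refine ⟨?_, ?_⟩
  · unfold klTowerD
    exact map_mem_evenOdd_zero ℂ _ (KLRegimeWick.klEffectiveAction_mem_evenOdd_zero β U μ K klE0 (j + 1))
  · unfold klTowerD
    rw [constPart_map]
    exact constPart_klEffectiveAction_eq_zero β U μ K klE0 (j + 1) hZ

/-- **The canonical pin radius tends to infinity.** [folklore] -/
theorem tower_radius_tendsto (β : ℝ) : Tendsto (fun L : ℕ => L / (4 * nScales β + 7)) atTop atTop := by
  rw [tendsto_atTop_atTop]
  intro B
  refine ⟨(4 * nScales β + 7) * B, fun L hL => (Nat.le_div_iff_mul_le (by positivity)).2 ?_⟩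
  rw [mul_comm]; exact hL

/-- **The canonical pin radius leaves room for the deepest pins**: `2·(2(n_β+1)·r_L + r_L) < L` for `0 < L`. [folklore] -/
theorem tower_radius_deep (β : ℝ) (L : ℕ) (hL : 0 < L) :
    2 * (2 * (nScales β + 1) * (L / (4 * nScales β + 7)) + L / (4 * nScales β + 7)) < L := by
  have h1 : (4 * nScales β + 7) * (L / (4 * nScales β + 7)) ≤ L := Nat.mul_div_le L _
  rcases Nat.eq_zero_or_pos (L / (4 * nScales β + 7)) with hq | hq
  · rw [hq]; simpa using hL
  · nlinarith [h1, hq]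

/-- **The canonical split of the grid-base radii**: `R = √r`, `R′ = r − √r`. [folklore] -/
theorem tower_radii_sqrt (r : ℕ → ℕ) (hr : Tendsto r atTop atTop) :
    (∀ L, Nat.sqrt (r L) + (r L - Nat.sqrt (r L)) ≤ r L) ∧
    Tendsto (fun L => (1 + (Nat.sqrt (r L) : ℝ)) / (1 + (((r L - Nat.sqrt (r L) : ℕ) : ℝ) + 1))) atTop (𝓝 0) ∧
    Tendsto (fun L => ((((r L - Nat.sqrt (r L) : ℕ) : ℝ)) + 1)⁻¹) atTop (𝓝 0) ∧
    Tendsto (fun L => Nat.sqrt (r L)) atTop atTop := by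
  have hsle : ∀ L, Nat.sqrt (r L) ≤ r L := fun L => Nat.sqrt_le_self _
  -- `√r → ∞`
  have hs : Tendsto (fun L => Nat.sqrt (r L)) atTop atTop := by
    rw [tendsto_atTop_atTop]
    intro B
    obtain ⟨N, hN⟩ := (tendsto_atTop_atTop.1 hr) (B * B)
    exact ⟨N, fun L hL => Nat.le_sqrt.2 (hN L hL)⟩
  have hsR : Tendsto (fun L => (Nat.sqrt (r L) : ℝ)) atTop atTop := tendsto_natCast_atTop_atTop.comp hs
  -- `(r − √r) + 1 ≥ √r`
  have hlow : ∀ L, (Nat.sqrt (r L) : ℝ) ≤ (((r L - Nat.sqrt (r L) : ℕ) : ℝ)) + 1 := by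
    intro L
    have h1 : ((Nat.sqrt (r L) : ℝ)) * (Nat.sqrt (r L) : ℝ) ≤ (r L : ℝ) := by exact_mod_cast Nat.sqrt_le (r L)
    rw [Nat.cast_sub (hsle L)]
    nlinarith [h1, sq_nonneg ((Nat.sqrt (r L) : ℝ) - 1)]
  refine ⟨fun L => (Nat.add_sub_cancel' (hsle L)).le, ?_, ?_, hs⟩
  · -- `(1+s)/(2 + (r-s)) ≤ (1+s)/(1+s) · …`: bound by `4/(s+1)` via `r - s ≥ s² - s`
    have hb : ∀ L, (1 + (Nat.sqrt (r L) : ℝ)) / (1 + (((r L - Nat.sqrt (r L) : ℕ) : ℝ) + 1)) ≤ 4 / ((Nat.sqrt (r L) : ℝ) + 1) := by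
      intro L
      set s : ℝ := (Nat.sqrt (r L) : ℝ) with hsdef
      have hs0 : 0 ≤ s := Nat.cast_nonneg _
      have h1 : (Nat.sqrt (r L) * Nat.sqrt (r L) : ℕ) ≤ r L := Nat.sqrt_le (r L)
      have hm : s * s - s ≤ (((r L - Nat.sqrt (r L) : ℕ) : ℝ)) := by
        rw [Nat.cast_sub (hsle L)]
        have : (s * s : ℝ) ≤ (r L : ℝ) := by rw [hsdef]; exact_mod_cast h1
        linarith
      rw [div_le_div_iff₀ (by positivity) (by positivity)]
      nlinarith [hm, hs0, sq_nonneg (s - 1)]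
    refine squeeze_zero (fun L => by positivity) hb ?_
    exact tendsto_const_nhds.div_atTop (tendsto_atTop_add_const_right _ 1 hsR)
  · have hden : Tendsto (fun L => (((r L - Nat.sqrt (r L) : ℕ) : ℝ)) + 1) atTop atTop := tendsto_atTop_mono hlow hsR
    exact tendsto_inv_atTop_zero.comp hden

/-- **`0 < ε_M ≤ 1` once `β ≤ 2M`** (`ε_M = imagTimeWeight β M = β/(2M)`). [folklore] -/
theorem imagTimeWeight_pos_le_one {β : ℝ} (hβ : 0 < β) {M : ℕ} (hM : β ≤ 2 * (M : ℝ)) :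
    0 < imagTimeWeight β M ∧ imagTimeWeight β M ≤ 1 := by
  have hM0 : (0 : ℝ) < 2 * (M : ℝ) := lt_of_lt_of_le hβ hM
  unfold imagTimeWeight
  exact ⟨div_pos hβ hM0, (div_le_one hM0).2 hM⟩

end Summit.HubbardSuperconductivity.HubbardSuperconductivity.Theorems.TwoVolumeSource

end
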